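import Summits.BirchSwinnertonDyer.BirchSwinnertonDyer.Theorems.AdditiveKolyvaginRoadRationalPlusSymbolTable
import Summits.BirchSwinnertonDyer.BirchSwinnertonDyer.Theorems.AdditiveKolyvaginRoadRankZeroBSDpOfKuriharaRoad
import HarnessLib

/-!
# Route `AdditiveKolyvaginRoad`, crux KS′ `LevelKolyvaginSystemsAdditive` (item stmt-BirchSwinnertonDyer-21396): the Kurihara-road doors in
# MANIN-ONLY form — the rational plus-symbol table discharged everywhere
# (sequel of `…RationalPlusSymbolTable.lean` / `…RankZeroBSDpOfKuriharaRoad.lean`; cell `pub/bsd-wall`, width seat `bsd-wall-akr-p2x-w4` g6;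
# `--supports stmt-BirchSwinnertonDyer-21396`, helper)

THEOREMS ONLY (no definition, no named fact, no `sorry`).  BSD is not proved by any of this; every print input stays a displayed hypothesis.

With `KuriharaRoad.exists_rational_plusSymbolTable` (p651652: a rational plus-symbol table exists for every parametrisation with `c ≠ 0`), the
two remaining consumers of the table lose that binder:

* `exists_kolyvaginClass_ne_zero_of_kuriharaRoad_of_manin` — the ♯-frame corollary (`…_of_lowerHalf_of_kuriharaRoad`, p648775 §3) with `hDt`
  reduced to «every minimal twist model has a parametrisation `Dt′` with `p ∤ c(Dt′)`».
* `bsdp_addv_potGood_rankZero_of_kuriharaSupply_of_manin` — the class-level door (p651184) on a non-CM additive potentially good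
  analytic-rank-0 row with `ρ̄` onto, `p > 7`: the binders `ms`, `hms` are gone (produced from `p ∤ c(Dt)`); `Kur` is supplied by the
  C⁺-shaped `hC` for the produced table.

References (locators only): [cite: KimNakamura2020, Thm 1.7, Rem. 1.8] [cite: Manin1972, Cor. 3.6] [cite: Kato2004Asterisque, Thm. 14.5 (3)].
-/

-- single-conjunct summit: `Summit.BirchSwinnertonDyer.BirchSwinnertonDyer.…` repeats the name by design
set_option linter.dupNamespace false
set_option autoImplicit false

noncomputable section

open scoped Classical

namespace Summit.BirchSwinnertonDyer.BirchSwinnertonDyer.Theorems.AdditiveKoly.KuriharaRoad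

open WeierstrassCurve NumberField
  Literature.NumberTheory.EllipticCurves Literature.NumberTheory.EllipticCurves.ModularForms
  Literature.NumberTheory.EllipticCurves.Rank1Residual Literature.NumberTheory.EllipticCurves.Rank1Residual.Typed
  Summit.BirchSwinnertonDyer.Rank1Residual Summit.BirchSwinnertonDyer.Rank1Residual.X11b
  Summit.BirchSwinnertonDyer.Rank1Residual.X11b.Three

variable (p : ℕ) [hp : Fact p.Prime]

/-- **KOLYVAGIN'S CONJECTURE MOD `p` AT A ♯ FRAME WITH `p > 7` FROM LOW₁ AND THE KURIHARA ROAD — Manin-only form.**  As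
`exists_kolyvaginClass_ne_zero_of_lowerHalf_of_kuriharaRoad` (p648775 §3) with the binder `hDt` reduced to: every globally minimal model of
`E^{(d_K)}` has a modular parametrisation with `p ∤ c` (`hManin`).  CONDITIONAL on every displayed binder; nothing booked.
[cite: KimNakamura2020, Thm 1.7] [cite: Manin1972, Cor. 3.6] -/
theorem exists_kolyvaginClass_ne_zero_of_kuriharaRoad_of_manin
    (W : WeierstrassCurve ℚ) [W.IsElliptic] [W.IsGloballyMinimal] [NeZero (W.conductorNorm ℤ)]
    (K : Type) [Field K] [NumberField K]
    (Dt : ModularParametrizationData W (W.conductorNorm ℤ)) (β : ℤ) (ι : K →+* ℂ)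
    -- published inputs (named facts of the tree)
    (hGZ : gross_zagier (W.conductorNorm ℤ) W K) (hKo : kolyvagin (W.conductorNorm ℤ) W K)
    (hKoB : Kolyvagin1990_padicValNat_card_sha_le (W.conductorNorm ℤ) W K)
    (hGZK : rank_eq_analyticRank_of_analyticRank_le_one) (hmod : hasEntireLFunction_rat)
    (hMc : McCallum1991_padicValNat_card_sha_primary_add_le_of_globalDivisibility)
    -- the Kurihara road (displayed, not asserted)
    (Kur : ∀ (X : WeierstrassCurve ℚ) [NeZero (X.conductorNorm ℤ)],
      ModularParametrizationData X (X.conductorNorm ℤ) → (ℚ → ℚ) → Prop)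
    (hKN : ∀ (X : WeierstrassCurve ℚ) [X.IsElliptic] [X.IsGloballyMinimal] [NeZero (X.conductorNorm ℤ)]
      (Dt : ModularParametrizationData X (X.conductorNorm ℤ)) (ms : ℚ → ℚ),
      7 < p → Addv X p → X.HasSurjectiveModNGaloisRep p → ¬ p ∣ X.tamagawaProduct →
      (∀ (ℓ : ℕ) [Fact ℓ.Prime], X.HasMultiplicativeReductionAtPrime ℓ → ¬ p ∣ (ℓ - 1) * (ℓ + 1)) →
      ¬ (p : ℤ) ∣ Dt.c → X.analyticRank = 0 →
      (∀ r : ℚ, (modularSymbol Dt.f r).re = (ms r : ℝ) * X.realPeriodRat) →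
      Kur X Dt ms → MissingLowerBoundAt X p)
    (hC : ∀ (X : WeierstrassCurve ℚ) [X.IsElliptic] [X.IsGloballyMinimal] [NeZero (X.conductorNorm ℤ)]
      (Dt : ModularParametrizationData X (X.conductorNorm ℤ)) (ms : ℚ → ℚ),
      5 ≤ p → ¬ X.HasCM → Addv X p → X.HasSurjectiveModNGaloisRep p → X.analyticRank = 0 →
      (∀ r : ℚ, (modularSymbol Dt.f r).re = (ms r : ℝ) * X.realPeriodRat) → Kur X Dt ms)
    (hManin : ∀ (Wd : WeierstrassCurve ℚ) [Wd.IsElliptic] [Wd.IsGloballyMinimal] [NeZero (Wd.conductorNorm ℤ)] (Cd : VariableChange ℚ),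
      Cd • W.quadraticTwist (NumberField.discr K : ℚ) = Wd →
      ∃ Dt' : ModularParametrizationData Wd (Wd.conductorNorm ℤ), ¬ (p : ℤ) ∣ Dt'.c)
    -- the frame
    (h7 : 7 < p) (hadd : Addv W p) (hs : W.HasSurjectiveModNGaloisRep p) (hCM : ¬ W.HasCM)
    (htam : ¬ p ∣ W.tamagawaProduct)
    (hmult : ∀ (ℓ : ℕ) [Fact ℓ.Prime], W.HasMultiplicativeReductionAtPrime ℓ → ¬ p ∣ (ℓ - 1) * (ℓ + 1))
    (hr : W.analyticRank = 1)
    (hK : IsImaginaryQuadratic K) (hodd : Odd (NumberField.discr K)) (hlt : NumberField.discr K < -4)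
    (hH : SatisfiesHeegnerHypothesis (W.conductorNorm ℤ) K)
    (hL : (W.quadraticTwist (NumberField.discr K : ℚ)).entireLFunction 1 ≠ 0)
    (hβ : (4 * (W.conductorNorm ℤ : ℤ)) ∣ β ^ 2 - NumberField.discr K) (hc : ¬ (p : ℤ) ∣ Dt.c)
    -- LOW₁ for `E`
    (hlow : MissingLowerBoundAt W p) :
    ∃ (n : ℕ) (d : KolyvaginHeegnerData Dt β ι n),
      KolyvaginDescent.KolSupp (Zhang2014.IsKolyvaginPrime (W.conductorNorm ℤ) W K p) n ∧
        d.kolyvaginClass hp.out 1 ≠ 0 :=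
  exists_kolyvaginClass_ne_zero_of_lowerHalves W p K Dt β ι hGZ hKo hKoB hGZK hmod hMc (by omega) hadd hs hCM htam hr hK hodd
    hlt hH hL hβ hc hlow
    (lowerHalf_twist_of_kuriharaRoad_of_manin W p K Kur hKN hC hmod h7 hadd hs hCM htam hmult hK hodd hH hL hManin)

/-- **`BSD_p` ON A NON-CM ADDITIVE POTENTIALLY GOOD ANALYTIC-RANK-0 ROW (`ρ̄` onto, `p > 7`) — Manin-only form.**  As
`bsdp_addv_potGood_rankZero_of_kuriharaSupply` (p651184) without the plus-symbol-table binders `ms`, `hms`: the table is produced from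
`p ∤ c(Dt)` (`exists_rational_plusSymbolTable`), `Kur` from `hC`, LOWER from `hKN`, UPPER from Kato.  Displayed print inputs: `hKN`, `hC`, `hKato`,
`hGZK`, `hmod`; row binders: `7 < p`, non-CM, `Addv`, `0 ≤ ord_p j`, `ρ̄` onto, `p ∤ ∏ c_ℓ`, `p ∤ (ℓ−1)(ℓ+1)` at mult `ℓ`, `r_an = 0`, `Dt` with
`p ∤ c(Dt)`. [cite: KimNakamura2020, Thm 1.7, Rem. 1.8] [cite: Kato2004Asterisque, Thm. 14.5 (3)] [cite: Manin1972, Cor. 3.6] -/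
theorem bsdp_addv_potGood_rankZero_of_kuriharaSupply_of_manin
    (Kur : ∀ (X : WeierstrassCurve ℚ) [NeZero (X.conductorNorm ℤ)],
      ModularParametrizationData X (X.conductorNorm ℤ) → (ℚ → ℚ) → Prop)
    (hKN : ∀ (X : WeierstrassCurve ℚ) [X.IsElliptic] [X.IsGloballyMinimal] [NeZero (X.conductorNorm ℤ)]
      (Dt : ModularParametrizationData X (X.conductorNorm ℤ)) (ms : ℚ → ℚ),
      7 < p → Addv X p → X.HasSurjectiveModNGaloisRep p → ¬ p ∣ X.tamagawaProduct →
      (∀ (ℓ : ℕ) [Fact ℓ.Prime], X.HasMultiplicativeReductionAtPrime ℓ → ¬ p ∣ (ℓ - 1) * (ℓ + 1)) →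
      ¬ (p : ℤ) ∣ Dt.c → X.analyticRank = 0 →
      (∀ r : ℚ, (modularSymbol Dt.f r).re = (ms r : ℝ) * X.realPeriodRat) →
      Kur X Dt ms → MissingLowerBoundAt X p)
    (hC : ∀ (X : WeierstrassCurve ℚ) [X.IsElliptic] [X.IsGloballyMinimal] [NeZero (X.conductorNorm ℤ)]
      (Dt : ModularParametrizationData X (X.conductorNorm ℤ)) (ms : ℚ → ℚ),
      5 ≤ p → ¬ X.HasCM → Addv X p → X.HasSurjectiveModNGaloisRep p → X.analyticRank = 0 →
      (∀ r : ℚ, (modularSymbol Dt.f r).re = (ms r : ℝ) * X.realPeriodRat) → Kur X Dt ms)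
    (hKato : Kato2004.rankZero_padicValNat_sha_le_of_additive_potGood_of_imageContainsSL2)
    (hGZK : rank_eq_analyticRank_of_analyticRank_le_one) (hmod : hasEntireLFunction_rat)
    (W : WeierstrassCurve ℚ) [W.IsElliptic] [W.IsGloballyMinimal] [NeZero (W.conductorNorm ℤ)]
    (h7 : 7 < p) (hCM : ¬ W.HasCM) (hadd : Addv W p) (hpot : 0 ≤ padicValRat p W.j) (hs : W.HasSurjectiveModNGaloisRep p)
    (htam : ¬ p ∣ W.tamagawaProduct)
    (hmult : ∀ (ℓ : ℕ) [Fact ℓ.Prime], W.HasMultiplicativeReductionAtPrime ℓ → ¬ p ∣ (ℓ - 1) * (ℓ + 1))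
    (hr : W.analyticRank = 0)
    (Dt : ModularParametrizationData W (W.conductorNorm ℤ)) (hc : ¬ (p : ℤ) ∣ Dt.c) :
    BSDp W p := by
  have hc0 : Dt.c ≠ 0 := fun h ↦ hc (by rw [h]; exact dvd_zero _)
  obtain ⟨ms, hms⟩ := exists_rational_plusSymbolTable W Dt hc0
  exact bsdp_addv_potGood_rankZero_of_kuriharaSupply p Kur hKN hC hKato hGZK hmod W h7 hCM hadd hpot hs htam hmult hr Dt hc ms hms

end Summit.BirchSwinnertonDyer.BirchSwinnertonDyer.Theorems.AdditiveKoly.KuriharaRoad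

end
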